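import Literature.AnabelianGeometry.AbsoluteAnabelian.AbsTopICharacterRankPoincareExtension
import HarnessLib

/-!
# [AbsTopI] Lemma 4.5 (iii), Poincaré-extension form — CONSUMER SHAPE over an exact sequence
# `0 → ker π → V —π→ P → 0` with the duality pairing given on the consumer's own `P`

Proof-only companion of `AbsTopICharacterRankPoincareExtension.lean` (S. Mochizuki, *Topics in Absolute
Anabelian Geometry I: Generalities* [MochizukiAbsTopI2012], Lemma 4.5 (iii), kurims manuscript p. 54;
[CombGC] = [MochizukiCombGC2007] Prop. 1.3 p. 9, Prop. 2.4 (ii)(iii)(vii) pp. 19–20, Cor. 2.7 (i) proof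
p. 23), cell abc-iut, block F, seat abc-iut-f-062 (FACT-LIST schemata F-0222 · F-0223 · F-0224).
The sequel's theorems take the Poincaré pairing on the literal quotient `V ⧸ C` together with a quotient
representation `ρP` intertwined by `C.mkQ`.  A geometric consumer (the étale-`π₁` model of
`V = H^{ab} ⊗ ℚ_l = Δ_U^{ab} ⊗ ℚ_l`, FOUNDATIONS row 12) naturally holds instead: its OWN module
`P = Δ_X^{ab} ⊗ ℚ_l` (any universe) with representation `ρP`, the `G`-equivariant SURJECTION `π : V ↠ P`
induced by `U ⊂ X` (whose kernel is the cuspidal part, [CombGC] Prop. 2.4 (ii) / Rmk. 1.3.1), and the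
cup-product pairing on `P` ([CombGC] Prop. 1.3).  This file DESCENDS such data to the quotient
(`exists_quotient_pairing_of_surjective`: `V ⧸ ker π ≅ P` via `Submodule.liftQ`, the pairing pulled back,
nondegeneracy and equivariance preserved) and restates A3 / A7 / A9, the three sentences of Lemma 4.5
(iii) and `d_{χ^{cyclo}}(V) = dim ker π` in that shape (`…_of_exact`), with the rank bookkeeping
`dim ker π + dim P = dim V`.  No new definitions.  HONEST FRAMING: refereed pre-IUT anabelian geometry
(linear algebra of `G`-modules); the geometric instance is not constructed here; typed ≠ proved for it;
nothing here bears on [IUTchIII] Cor. 3.12.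
-/

noncomputable section

open scoped Classical

namespace Literature.AnabelianGeometry.AbsoluteAnabelian.AbsTopI

universe u v w w'

section Exact

variable {G : Type u} [Group G] [TopologicalSpace G]
variable {K : Type v} [Field K]
variable {V : Type w} [AddCommGroup V] [Module K V]
variable {P : Type w'} [AddCommGroup P] [Module K P]

omit [TopologicalSpace G] in
/-- The kernel of an equivariant linear map is a stable submodule ("`ℚ_l[G]`-submodule").
[cite: MochizukiAbsTopI2012, Lemma 4.5 (ii) p.54] -/
theorem isStable_ker {ρV : G →* (V ≃ₗ[K] V)} {ρP : G →* (P ≃ₗ[K] P)} (π : V →ₗ[K] P)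
    (hπ : ∀ (g : G) (v : V), π (ρV g v) = ρP g (π v)) : IsStable ρV (LinearMap.ker π) := by
  intro g v hv
  rw [LinearMap.mem_ker] at hv ⊢
  rw [hπ, hv, map_zero]

omit [TopologicalSpace G] in
/-- Rank bookkeeping along `0 → ker π → V → P → 0`: `dim ker π + dim P = dim V` (so the cusp count
`r = dim ker π + 1` reads `dim V − dim P + 1`). [cite: MochizukiCombGC2007, Rmk. 1.3.1 p.10] -/
theorem finrank_ker_add_finrank_of_surjective [FiniteDimensional K V] (π : V →ₗ[K] P)
    (hπs : Function.Surjective π) :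
    Module.finrank K ↥(LinearMap.ker π) + Module.finrank K P = Module.finrank K V := by
  haveI : FiniteDimensional K P := Module.Finite.of_surjective π hπs
  have h := LinearMap.finrank_range_add_finrank_ker π
  rw [LinearMap.range_eq_top.2 hπs, finrank_top] at h
  omega

omit [TopologicalSpace G] in
/-- **Descent of the duality datum to the quotient.**  From an equivariant surjection `π : V ↠ P` and a
`G`-equivariant nondegenerate `χ^{cyclo}`-valued pairing `B` on `P`: a representation on `V ⧸ ker π`
intertwined with `ρV` by `mkQ`, and an equivariant nondegenerate `χ^{cyclo}`-valued pairing on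
`V ⧸ ker π` (pull-back of `B` along `V ⧸ ker π ≅ P`). [cite: MochizukiCombGC2007, Prop. 1.3 p.9] -/
theorem exists_quotient_pairing_of_surjective (ρV : G →* (V ≃ₗ[K] V)) (ρP : G →* (P ≃ₗ[K] P))
    (π : V →ₗ[K] P) (hπs : Function.Surjective π) (hπ : ∀ (g : G) (v : V), π (ρV g v) = ρP g (π v))
    {χ : G →* Kˣ} (B : P →ₗ[K] P →ₗ[K] K)
    (hB : ∀ (g : G) (p q : P), B (ρP g p) (ρP g q) = (χ g : K) * B p q)
    (hBl : ∀ p : P, (∀ q : P, B p q = 0) → p = 0) :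
    ∃ (ρQ : G →* ((V ⧸ LinearMap.ker π) ≃ₗ[K] (V ⧸ LinearMap.ker π)))
      (B' : (V ⧸ LinearMap.ker π) →ₗ[K] (V ⧸ LinearMap.ker π) →ₗ[K] K),
      (∀ (g : G) (m : V), ρQ g ((LinearMap.ker π).mkQ m) = (LinearMap.ker π).mkQ (ρV g m)) ∧
      (∀ (g : G) (p q : V ⧸ LinearMap.ker π), B' (ρQ g p) (ρQ g q) = (χ g : K) * B' p q) ∧
      (∀ p : V ⧸ LinearMap.ker π, (∀ q : V ⧸ LinearMap.ker π, B' p q = 0) → p = 0) := by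
  obtain ⟨ρQ, hρQ⟩ := exists_quotientRepresentation ρV (isStable_ker π hπ)
  let e : (V ⧸ LinearMap.ker π) →ₗ[K] P := (LinearMap.ker π).liftQ π le_rfl
  have he : ∀ v : V, e ((LinearMap.ker π).mkQ v) = π v := fun v => Submodule.liftQ_apply _ _ _
  have heinj : Function.Injective e := by
    rw [← LinearMap.ker_eq_bot]
    exact Submodule.ker_liftQ_eq_bot _ _ _ le_rfl
  refine ⟨ρQ, B.compl₁₂ e e, hρQ, fun g p q => ?_, fun p hp => ?_⟩
  · obtain ⟨x, rfl⟩ := (LinearMap.ker π).mkQ_surjective p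
    obtain ⟨y, rfl⟩ := (LinearMap.ker π).mkQ_surjective q
    rw [hρQ, hρQ, LinearMap.compl₁₂_apply, LinearMap.compl₁₂_apply, he, he, he, he, hπ, hπ, hB]
  · obtain ⟨x, rfl⟩ := (LinearMap.ker π).mkQ_surjective p
    have hzero : e ((LinearMap.ker π).mkQ x) = 0 := by
      apply hBl
      intro q
      obtain ⟨y, rfl⟩ := hπs q
      have h1 := hp ((LinearMap.ker π).mkQ y)
      rwa [LinearMap.compl₁₂_apply, he, he] at h1
    exact heinj (by rw [hzero, map_zero])

/-- **A3 ([CombGC] Prop. 2.4 (iii)) in consumer shape**: `det(V)²` is a positive power of `χ^{cyclo}` on an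
open subgroup of finite index, for `V ≠ 0` with quasi-toral `ker π` and a nondegenerate equivariant
`χ^{cyclo}`-valued pairing on `P`. [cite: MochizukiCombGC2007, Prop. 2.4 (iii) p.19] -/
theorem detSqQuasiCyclotomic_of_exact [FiniteDimensional K V] (χcyclo : G →* Kˣ)
    (ρV : G →* (V ≃ₗ[K] V)) (hV : 0 < Module.finrank K V) (ρP : G →* (P ≃ₗ[K] P)) (π : V →ₗ[K] P)
    (hπs : Function.Surjective π) (hπ : ∀ (g : G) (v : V), π (ρV g v) = ρP g (π v))
    (hKt : ∃ U : Subgroup G, IsOpen (U : Set G) ∧ U.FiniteIndex ∧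
      ∀ g ∈ U, ∀ v ∈ LinearMap.ker π, ρV g v = (χcyclo g : K) • v)
    (B : P →ₗ[K] P →ₗ[K] K) (hB : ∀ (g : G) (p q : P), B (ρP g p) (ρP g q) = (χcyclo g : K) * B p q)
    (hBl : ∀ p : P, (∀ q : P, B p q = 0) → p = 0) :
    DetSqQuasiCyclotomic χcyclo ρV := by
  obtain ⟨ρQ, B', hρQ, hB', hBl'⟩ := exists_quotient_pairing_of_surjective ρV ρP π hπs hπ B hB hBl
  exact detSqQuasiCyclotomic_of_poincareExtension χcyclo ρV hV (isStable_ker π hπ) hKt ρQ hρQ B' hB' hBl'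

/-- **A7 ([CombGC] Prop. 2.4 (vii)) in consumer shape**: realised weights finite and symmetric under
`λ ↦ 2 − λ`, for non-degenerate `χ^{cyclo}`, NONZERO quasi-toral `ker π` ("`G` has cusps") and a
nondegenerate equivariant `χ^{cyclo}`-valued pairing on `P`. [cite: MochizukiCombGC2007, Prop. 2.4 (vii) p.20] -/
theorem realisedWeightsSymmetric_of_exact [FiniteDimensional K V] (χcyclo : G →* Kˣ)
    (hcyc : ∀ U : Subgroup G, IsOpen (U : Set G) → U.FiniteIndex →
      ∀ a : ℤ, a ≠ 0 → ∃ g ∈ U, χcyclo g ^ a ≠ 1)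
    (ρV : G →* (V ≃ₗ[K] V)) (ρP : G →* (P ≃ₗ[K] P)) (π : V →ₗ[K] P)
    (hπs : Function.Surjective π) (hπ : ∀ (g : G) (v : V), π (ρV g v) = ρP g (π v))
    (hK0 : LinearMap.ker π ≠ ⊥)
    (hKt : ∃ U : Subgroup G, IsOpen (U : Set G) ∧ U.FiniteIndex ∧
      ∀ g ∈ U, ∀ v ∈ LinearMap.ker π, ρV g v = (χcyclo g : K) • v)
    (B : P →ₗ[K] P →ₗ[K] K) (hB : ∀ (g : G) (p q : P), B (ρP g p) (ρP g q) = (χcyclo g : K) * B p q)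
    (hBl : ∀ p : P, (∀ q : P, B p q = 0) → p = 0) :
    RealisedWeightsSymmetric χcyclo ρV := by
  obtain ⟨ρQ, B', hρQ, hB', hBl'⟩ := exists_quotient_pairing_of_surjective ρV ρP π hπs hπ B hB hBl
  exact realisedWeightsSymmetric_of_poincareExtension χcyclo hcyc ρV (isStable_ker π hπ) hK0 hKt ρQ hρQ
    B' hB' hBl'

/-- **A9 (the count of [CombGC] Cor. 2.7 (i)) in consumer shape**: `τ(V((χ^{cyclo})⁻¹)) − τ(V) + 1 =
dim ker π + 1` (`= dim V − dim P + 1`, the number of cusps). [cite: MochizukiCombGC2007, Cor. 2.7 (i) proof p.23] -/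
theorem cuspCountViaWeights_of_exact [FiniteDimensional K V] (χcyclo : G →* Kˣ)
    (hcyc : ∀ U : Subgroup G, IsOpen (U : Set G) → U.FiniteIndex →
      ∀ a : ℤ, a ≠ 0 → ∃ g ∈ U, χcyclo g ^ a ≠ 1)
    (ρV : G →* (V ≃ₗ[K] V)) (ρP : G →* (P ≃ₗ[K] P)) (π : V →ₗ[K] P)
    (hπs : Function.Surjective π) (hπ : ∀ (g : G) (v : V), π (ρV g v) = ρP g (π v))
    (hKt : ∃ U : Subgroup G, IsOpen (U : Set G) ∧ U.FiniteIndex ∧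
      ∀ g ∈ U, ∀ v ∈ LinearMap.ker π, ρV g v = (χcyclo g : K) • v)
    (B : P →ₗ[K] P →ₗ[K] K) (hB : ∀ (g : G) (p q : P), B (ρP g p) (ρP g q) = (χcyclo g : K) * B p q)
    (hBl : ∀ p : P, (∀ q : P, B p q = 0) → p = 0) :
    CuspCountViaWeights χcyclo ρV (Module.finrank K ↥(LinearMap.ker π) + 1) := by
  obtain ⟨ρQ, B', hρQ, hB', hBl'⟩ := exists_quotient_pairing_of_surjective ρV ρP π hπs hπ B hB hBl
  exact cuspCountViaWeights_of_poincareExtension χcyclo hcyc ρV (isStable_ker π hπ) hKt ρQ hρQ B' hB' hBl'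

/-- **F-0224 `Lem45iii_det` in consumer shape.** [cite: MochizukiAbsTopI2012, Lemma 4.5 (iii) p.54] -/
theorem lem45iii_det_of_exact [FiniteDimensional K V] (χcyclo : G →* Kˣ)
    (ρV : G →* (V ≃ₗ[K] V)) (hV : 0 < Module.finrank K V) (ρP : G →* (P ≃ₗ[K] P)) (π : V →ₗ[K] P)
    (hπs : Function.Surjective π) (hπ : ∀ (g : G) (v : V), π (ρV g v) = ρP g (π v))
    (hKt : ∃ U : Subgroup G, IsOpen (U : Set G) ∧ U.FiniteIndex ∧
      ∀ g ∈ U, ∀ v ∈ LinearMap.ker π, ρV g v = (χcyclo g : K) • v)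
    (B : P →ₗ[K] P →ₗ[K] K) (hB : ∀ (g : G) (p q : P), B (ρP g p) (ρP g q) = (χcyclo g : K) * B p q)
    (hBl : ∀ p : P, (∀ q : P, B p q = 0) → p = 0) :
    Lem45iii_det χcyclo ρV := by
  obtain ⟨ρQ, B', hρQ, hB', hBl'⟩ := exists_quotient_pairing_of_surjective ρV ρP π hπs hπ B hB hBl
  exact lem45iii_det_of_poincareExtension χcyclo ρV hV (isStable_ker π hπ) hKt ρQ hρQ B' hB' hBl'

/-- **F-0223 `Lem45iii_cycloClass` in consumer shape** (`ker π ≠ 0`: the curve has `r ≥ 2` cusps on the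
covering — "sufficiently small `H`"). [cite: MochizukiAbsTopI2012, Lemma 4.5 (iii) p.54] -/
theorem lem45iii_cycloClass_of_exact [FiniteDimensional K V] (χcyclo : G →* Kˣ)
    (hcyc : ∀ U : Subgroup G, IsOpen (U : Set G) → U.FiniteIndex →
      ∀ a : ℤ, a ≠ 0 → ∃ g ∈ U, χcyclo g ^ a ≠ 1)
    (ρV : G →* (V ≃ₗ[K] V)) (ρP : G →* (P ≃ₗ[K] P)) (π : V →ₗ[K] P)
    (hπs : Function.Surjective π) (hπ : ∀ (g : G) (v : V), π (ρV g v) = ρP g (π v))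
    (hK0 : LinearMap.ker π ≠ ⊥)
    (hKt : ∃ U : Subgroup G, IsOpen (U : Set G) ∧ U.FiniteIndex ∧
      ∀ g ∈ U, ∀ v ∈ LinearMap.ker π, ρV g v = (χcyclo g : K) • v)
    (B : P →ₗ[K] P →ₗ[K] K) (hB : ∀ (g : G) (p q : P), B (ρP g p) (ρP g q) = (χcyclo g : K) * B p q)
    (hBl : ∀ p : P, (∀ q : P, B p q = 0) → p = 0) :
    Lem45iii_cycloClass χcyclo ρV := by
  obtain ⟨ρQ, B', hρQ, hB', hBl'⟩ := exists_quotient_pairing_of_surjective ρV ρP π hπs hπ B hB hBl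
  exact lem45iii_cycloClass_of_poincareExtension χcyclo hcyc ρV (isStable_ker π hπ) hK0 hKt ρQ hρQ
    B' hB' hBl'

/-- **F-0222 `Lem45iii_cuspCount` in consumer shape**, with `r := dim ker π + 1` cusps.
[cite: MochizukiAbsTopI2012, Lemma 4.5 (iii) p.54] -/
theorem lem45iii_cuspCount_of_exact [FiniteDimensional K V] (χcyclo : G →* Kˣ)
    (hcyc : ∀ U : Subgroup G, IsOpen (U : Set G) → U.FiniteIndex →
      ∀ a : ℤ, a ≠ 0 → ∃ g ∈ U, χcyclo g ^ a ≠ 1)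
    (ρV : G →* (V ≃ₗ[K] V)) (ρP : G →* (P ≃ₗ[K] P)) (π : V →ₗ[K] P)
    (hπs : Function.Surjective π) (hπ : ∀ (g : G) (v : V), π (ρV g v) = ρP g (π v))
    (hKt : ∃ U : Subgroup G, IsOpen (U : Set G) ∧ U.FiniteIndex ∧
      ∀ g ∈ U, ∀ v ∈ LinearMap.ker π, ρV g v = (χcyclo g : K) • v)
    (B : P →ₗ[K] P →ₗ[K] K) (hB : ∀ (g : G) (p q : P), B (ρP g p) (ρP g q) = (χcyclo g : K) * B p q)
    (hBl : ∀ p : P, (∀ q : P, B p q = 0) → p = 0) :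
    Lem45iii_cuspCount χcyclo ρV (Module.finrank K ↥(LinearMap.ker π) + 1) := by
  obtain ⟨ρQ, B', hρQ, hB', hBl'⟩ := exists_quotient_pairing_of_surjective ρV ρP π hπs hπ B hB hBl
  exact lem45iii_cuspCount_of_poincareExtension χcyclo hcyc ρV (isStable_ker π hπ) hKt ρQ hρQ B' hB' hBl'

/-- **`d_{χ^{cyclo}}(V) = dim ker π = dim V − dim P`** in consumer shape (`r − 1`, the rank of the cuspidal
part). [cite: MochizukiAbsTopI2012, Lemma 4.5 (ii)(iii) p.54] [cite: MochizukiCombGC2007, Rmk. 1.3.1 p.10] -/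
theorem dChi_of_exact [FiniteDimensional K V] (χcyclo : G →* Kˣ)
    (hcyc : ∀ U : Subgroup G, IsOpen (U : Set G) → U.FiniteIndex →
      ∀ a : ℤ, a ≠ 0 → ∃ g ∈ U, χcyclo g ^ a ≠ 1)
    (ρV : G →* (V ≃ₗ[K] V)) (ρP : G →* (P ≃ₗ[K] P)) (π : V →ₗ[K] P)
    (hπs : Function.Surjective π) (hπ : ∀ (g : G) (v : V), π (ρV g v) = ρP g (π v))
    (hKt : ∃ U : Subgroup G, IsOpen (U : Set G) ∧ U.FiniteIndex ∧
      ∀ g ∈ U, ∀ v ∈ LinearMap.ker π, ρV g v = (χcyclo g : K) • v)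
    (B : P →ₗ[K] P →ₗ[K] K) (hB : ∀ (g : G) (p q : P), B (ρP g p) (ρP g q) = (χcyclo g : K) * B p q)
    (hBl : ∀ p : P, (∀ q : P, B p q = 0) → p = 0) :
    dChi ρV χcyclo = (Module.finrank K V : ℤ) - Module.finrank K P := by
  haveI : FiniteDimensional K P := Module.Finite.of_surjective π hπs
  obtain ⟨ρQ, B', hρQ, hB', hBl'⟩ := exists_quotient_pairing_of_surjective ρV ρP π hπs hπ B hB hBl
  have h := dChi_of_poincareExtension χcyclo hcyc ρV (isStable_ker π hπ) hKt ρQ hρQ B' hB' hBl'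
  have hrk := finrank_ker_add_finrank_of_surjective π hπs
  rw [h]
  omega

end Exact

end Literature.AnabelianGeometry.AbsoluteAnabelian.AbsTopI

end
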